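import Mathlib
import Summits.ValiantsHypothesis.ValiantsHypothesis.Theses.LiouvilleSarnak
import Summits.ValiantsHypothesis.ValiantsHypothesis.Theorems.LiouvilleSarnakLiouvilleCutRankSignPatterns
import Summits.ValiantsHypothesis.ValiantsHypothesis.Theorems.LiouvilleSarnakLiouvilleCutRankChowlaPatterns

/-!
# Route LiouvilleSarnak — crux `LiouvilleCutRank` (stmt-ValiantsHypothesis-14775):
# CHOWLA'S CONJECTURE ⇒ the crux

The chain assembled: `Literature.NumberTheory.Sieve.ChowlaConjecture` (parity.S06, the tree's named
open conjecture: `Σ_{n<x} λ(n+h₁)⋯λ(n+h_k) = o(x)` for distinct shifts)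
⟹ every finite sign pattern occurs in `λ` (`SignPatterns.signPatterns_of_chowla`, inclusion–exclusion)
⟹ the ONE-BLOCK form of the crux (`SignPatterns.exists_block_rank_ge_of_signPatterns`: pattern
`[¬ d ∣ j]`, subset sums of powers of two mod odd `d`, submatrix `J - 2I`)
⟹ `LiouvilleCutRank` (`OneBlock.liouvilleCutRank_of_oneBlock`: shifted window embedding + balanced
window with a top margin).

So ★ `liouvilleCutRank_of_chowla : ChowlaConjecture → LiouvilleCutRank`: the Nisan-width crux of route
LiouvilleSarnak is a CONSEQUENCE OF CHOWLA'S CONJECTURE — consistency evidence for the crux and a precise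
measure of what the open stub `stub_rankAtOneScale` asks of number theory (pattern / correlation control
of `λ` at length `2·4^{2W+2}` somewhere in the sequence, not on initial segments).

Honest framing: CONDITIONAL (Chowla's conjecture is open; it is the hypothesis, cited by its tree name);
`LiouvilleCutRank`, `DigitalBilinearLiouville` and `AlgebraicSarnak` stay OPEN unconditionally, and
nothing here bears on VP versus VNP.  No definitions.
-/

-- the directory `ValiantsHypothesis/ValiantsHypothesis` repeats the summit name (tree layout)
set_option linter.dupNamespace false

namespace Summit.ValiantsHypothesis.ValiantsHypothesis.Theorems.LiouvilleSarnakLiouvilleCutRank.SignPatterns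

open Summit.ValiantsHypothesis.ValiantsHypothesis.Theses.LiouvilleSarnak (LiouvilleCutRank)
open Literature.NumberTheory.Sieve (ChowlaConjecture)

/-- ★ **Chowla's conjecture ⇒ `LiouvilleCutRank`** (crux stmt-ValiantsHypothesis-14775): for every
`W`, eventually every balanced digital cut matrix of the Liouville function has rank `≥ W`, PROVIDED
Chowla's conjecture `Literature.NumberTheory.Sieve.ChowlaConjecture` holds
(`signPatterns_of_chowla`, then `liouvilleCutRank_of_signPatterns`). [folklore] -/
theorem liouvilleCutRank_of_chowla (hC : ChowlaConjecture) : LiouvilleCutRank :=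
  liouvilleCutRank_of_signPatterns (signPatterns_of_chowla hC)

end Summit.ValiantsHypothesis.ValiantsHypothesis.Theorems.LiouvilleSarnakLiouvilleCutRank.SignPatterns
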